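import Summits.PneNP.PneNP.Theorems.ChebyshevTracialDesignThreeWiseTightMatching
import HarnessLib

/-!
# Cell pnp-psdrank, route `ChebyshevTracialDesign`: the matching-side dual of the 3-wise lemma FAILS — three perfect matchings need not share a
# tight `t`-cut (crux `TracialDecayExp20`, stmt-PneNP-19878)

Brick 78b (prover g14; MEMO-17 §1). Brick 78 (`exists_three_tight_cut`): any THREE odd cuts share a tight perfect matching; brick 74
(`exists_common_tight_cut`): any TWO perfect matchings share a tight cut of every odd size. The common generalisation is false: in `K₆` the three
parallel classes of the hexagon-with-diagonals, `M₁ = {01,23,45}`, `M₂ = {12,34,50}`, `M₃ = {03,14,25}`, have NO common tight `3`-cut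
(`three_matchings_no_common_tight_cut`, kernel-checked by `decide` over the `64` vertex subsets). So the propagation step of the robust `r = 3`
programme is 3-wise on the CUT side only; on the matching side it must stay pairwise (MEMO-16 §6(e)(ii), MEMO-17 §1).
[cite: Rothvoss2017, §2 (PDF pp. 5–6: `δ(U)`, `|δ(U) ∩ M|`, the tight pairs `Q_1`)]
Stature: support/instrument (a finite counterexample). WHAT THIS IS NOT: nothing on values, psd rank of P_PM(K_n) or P-vs-NP.
-/

set_option linter.dupNamespace false -- `Summit.PneNP.PneNP.…`: summit = sub-problem (D-0017)

namespace Summit.PneNP.PneNP.Theorems.ChebyshevTracialDesignThreeWiseTightMatching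

open Finset Literature.Barriers.PneNP
open Literature.Combinatorics.SimpleGraph.CycleSpace
open Literature.Combinatorics.AssociationSchemes.CutMatchingRestriction

/-- **Three perfect matchings of `K₆` with no common tight `3`-cut**: `M₁ = {01,23,45}`, `M₂ = {12,34,50}`, `M₃ = {03,14,25}` are perfect matchings
of `Fin 6`, and no `3`-subset `U` has `cc(U,M₁) = cc(U,M₂) = cc(U,M₃) = 1`. (The matching-side dual of `exists_three_tight_cut` fails at
`(n,t) = (6,3)`.) [cite: Rothvoss2017, §2 (PDF p. 6: the tight pairs `Q_1`)] -/
theorem three_matchings_no_common_tight_cut :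
    IsPMOn (univ : Finset (Fin 6)) ({s(0, 1), s(2, 3), s(4, 5)} : Finset (Sym2 (Fin 6))) ∧
    IsPMOn (univ : Finset (Fin 6)) ({s(1, 2), s(3, 4), s(5, 0)} : Finset (Sym2 (Fin 6))) ∧
    IsPMOn (univ : Finset (Fin 6)) ({s(0, 3), s(1, 4), s(2, 5)} : Finset (Sym2 (Fin 6))) ∧
    ∀ U : Finset (Fin 6), U.card = 3 →
      ¬ (crossCount U ({s(0, 1), s(2, 3), s(4, 5)} : Finset (Sym2 (Fin 6))) = 1 ∧
         crossCount U ({s(1, 2), s(3, 4), s(5, 0)} : Finset (Sym2 (Fin 6))) = 1 ∧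
         crossCount U ({s(0, 3), s(1, 4), s(2, 5)} : Finset (Sym2 (Fin 6))) = 1) := by
  refine ⟨by decide, by decide, by decide, ?_⟩
  unfold crossCount
  decide

/-- Hence the statement 'any three perfect matchings of an even `K_n` share a tight `t`-cut for every odd `t ≤ n − 1`' is FALSE (witness `n = 6`,
`t = 3`), in the kernel's currency `PMatch 6`, `OddSet 6`, `cc`. [cite: Rothvoss2017, §2 (PDF p. 6: the tight pairs `Q_1`)] -/
theorem not_forall_three_matchings_common_tight_cut :
    ¬ ∀ (M₁ M₂ M₃ : PMatch 6), ∃ U : OddSet 6, U.1.card = 3 ∧ cc U M₁ = 1 ∧ cc U M₂ = 1 ∧ cc U M₃ = 1 := by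
  obtain ⟨h₁, h₂, h₃, hno⟩ := three_matchings_no_common_tight_cut
  intro h
  obtain ⟨U, hU, c₁, c₂, c₃⟩ := h ⟨_, h₁⟩ ⟨_, h₂⟩ ⟨_, h₃⟩
  exact hno U.1 hU ⟨c₁, c₂, c₃⟩

end Summit.PneNP.PneNP.Theorems.ChebyshevTracialDesignThreeWiseTightMatching
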